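import Literature.IUT.HodgeTheaters.PuncturedEllipticCoveringsCores
import Literature.IUT.HodgeTheaters.PuncturedEllipticCoveringsCuspsProofs
import Literature.IUT.HodgeTheaters.PuncturedEllipticCoveringsSplitting
import HarnessLib

/-!
# [IUTchI] Remark 1.2.1 (`Aut_k(X̲→) = Gal(X̲→/C̲)`, `Aut_k(C̲→) = Gal(C̲→/C̲)`) — proof-only

Mochizuki, *Inter-universal Teichmüller theory I*, kurims manuscript (May 2020), §1, Remark 1.2.1,
p. 40 ([IUTchI] Rmk 1.2.1 p.40) [claim: Mochizuki2012, status: disputed], quoted as printed: "It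
follows immediately from Corollary 1.2 that `Aut_k(X̲→) = Gal(X̲→/C̲) (≅ ℤ/2lℤ)`;
`Aut_k(C̲→) = Gal(C̲→/C̲) (≅ ℤ/lℤ)` [cf. [EtTh], Remark 2.6.1]." (the notation `X̲→`, `C̲→` is that of
[IUTchI] Def. 1.1, p. 38; on the arrow "`→`" itself see [IUTchI] Rmk. 1.1.1, p. 39) — typed by
abc-iut-L5-t1 (FROZEN `PuncturedEllipticCoverings.lean`) as the group-level predicate
`PuncturedEllipticData.Rmk121`: the normalisers of `Π_{X̲→}` and of `Π_{C̲→}` in the core `Π_C` are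
`Π_C̲`, with cyclic quotients of orders `2l`, `l`.  Node `IUTchI:Rmk1.2.1` (consumed as a HYPOTHESIS
by abc-iut-L5-d4's `characteristicNatureOfCoverings_of_core_isos`, `…Cores`).

PROOF-ONLY companion (no definitions, nothing restated): **`ArrowCoveringClaims.rmk121` — `Rmk121 D`
holds** under the printed claims of p. 38 (`ArrowCoveringClaims`), the cusp action (`CuspGalois`,
abc-iut-L5-t1's interface companion, consumed BY NAME) and the law `[Π_X : Π_X̲] = l` ([IUTchI]
Def. 3.1 (d); abc-iut-L5-t2 `ThetaGeometry.PiXbar_relIndex`).  ROUTE — THIS FILE'S OWN (print derives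
the Remark from Cor. 1.2; the direct group-theoretic argument below, via the action of `Gal(X̲/X)` on
the cusps of `X̲`, is the formaliser's and is NOT attributed to [IUTchI] or to [EtTh] Rmk. 2.6.1): an
element `g ∈ Π_X ∖ Π_X̲` normalising `Π_{X̲→}` normalises `Δ_{X̲→} = jKer`; some power
`g^k` moves `ε′` to a cusp `y ∉ {ε⁰, ε′, ε″}` (pigeonhole over `k = 0, …, 3`: a coincidence
`g^i·ε′ = g^j·ε′` would force `(act g)^d = 1` for some `1 ≤ d ≤ 3`, while `(act g)^l = 1` and `l` is
prime to `6` — `CuspGalois.exists_pow_act_not_mem_triple`); then `g^k I_{ε′} g^{-k}` lies in a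
`Π_X̲`-conjugate of `I_y ⊆ jKer` (`act_decomp`, `jKer ⊴ Π_C̲`), so `I_{ε′} ⊆ jKer ⊆ Π_{X̲→}` —
contradicting `I_{ε′} ⥲ Δ_Θ⁺` (`not_inertia_ε1_le_piXarrow`, p424465).  Hence
`N_{Π_C}(Π_{X̲→}) ∩ Π_X = Π_X̲` and, `Π_C̲ ∖ Π_X` being nonempty and `[Π_C : Π_X] = 2`,
`N_{Π_C}(Π_{X̲→}) = Π_C̲` (`normalizer_piXarrow_eq`); `N_{Π_C}(Π_{C̲→}) = Π_C̲` follows since an element of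
`Π_X` normalising `Π_{C̲→}` normalises `Π_X̲ ∩ Π_{C̲→} = Π_{X̲→}` (`Π_X̲ ⊴ Π_C`) (`normalizer_piCarrow_eq`).
Corollary: `characteristicNatureOfCoverings_of_core_isos'` — the `…Cores` assembly with its `Rmk121`
hypotheses discharged.  No side is taken on [IUTchIII] Cor. 3.12.
-/

namespace Literature.IUT.HodgeTheaters

namespace PuncturedEllipticData

open scoped Pointwise
open Literature.AnabelianGeometry.AbsoluteAnabelian

universe u

variable {D : PuncturedEllipticData.{u}}

/-! ### "By considering the action on cusps": a non-trivial Galois translate of `ε′` leaves `{ε⁰, ε′, ε″}` -/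

/-- For `g ∈ Π_X ∖ Π_X̲`, some power `g^k` carries the cusp `x` OUTSIDE `{ε⁰, ε′, ε″}`: otherwise two
of `x, g·x, g²·x, g³·x` coincide (pigeonhole), so `(act g)^d = 1` for some `1 ≤ d ≤ 3`; with
`(act g)^l = 1` (`g^l ∈ Π_X̲`, `[Π_X : Π_X̲] = l`) and `l` prime to `6` this forces `act g = 1`, i.e.
`g ∈ Π_X̲`. ([IUTchI] Rmk 1.2.1 p.40) [claim: Mochizuki2012, status: disputed] -/
theorem CuspGalois.exists_pow_act_not_mem_triple (C : D.CuspGalois)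
    (hX : D.PiXbar.relIndex D.PiX = D.l) {g : D.PiC} (hg : g ∈ D.PiX) (hgb : g ∉ D.PiXbar)
    (x : D.Cusp) : ∃ k : ℕ, C.act (g ^ k) x ∉ ({D.ε0, D.ε1, D.ε2} : Set D.Cusp) := by
  classical
  by_contra hall
  push Not at hall
  -- pigeonhole: `k ↦ g^k · x`, `k < 4`, into the three-element set
  have hmaps : Set.MapsTo (fun k : ℕ => C.act (g ^ k) x) (Finset.range 4 : Finset ℕ)
      ({D.ε0, D.ε1, D.ε2} : Finset D.Cusp) := by
    intro k _
    have hk := hall k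
    simp only [Set.mem_insert_iff, Set.mem_singleton_iff] at hk
    simp only [Finset.coe_insert, Finset.coe_singleton, Set.mem_insert_iff, Set.mem_singleton_iff]
    exact hk
  have hcard : Finset.card ({D.ε0, D.ε1, D.ε2} : Finset D.Cusp) < Finset.card (Finset.range 4) :=
    lt_of_le_of_lt Finset.card_le_three (by rw [Finset.card_range]; norm_num)
  obtain ⟨i, hi, j, hj, hij, hfij⟩ := Finset.exists_ne_map_eq_of_card_lt_of_maps_to hcard hmaps
  rw [Finset.mem_range] at hi hj
  -- a coincidence `g^i·x = g^j·x` with `i ≠ j < 4` gives `(act g)^d = 1`, `d = |i - j| ∈ {1,2,3}`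
  have key : ∀ a b : ℕ, a < b → b < 4 → C.act (g ^ a) x = C.act (g ^ b) x → False := by
    intro a b hab hb4 heq
    obtain ⟨d, rfl⟩ := Nat.exists_eq_add_of_lt hab
    -- `g^(a+d+1) x = g^a (g^(d+1) x)`, so `g^(d+1)` fixes `x`
    have hfix : C.act (g ^ (d + 1)) x = x := by
      rw [show a + d + 1 = a + (d + 1) by ring, pow_add, map_mul, Equiv.Perm.mul_apply] at heq
      exact (C.act (g ^ a)).injective heq.symm
    have hmem : g ^ (d + 1) ∈ D.PiXbar := C.free _ (D.PiX.pow_mem hg _) x hfix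
    have h1 : C.act g ^ (d + 1) = 1 := by rw [← map_pow]; exact C.act_eq_one_of_mem_PiXbar hmem
    -- `(act g)^l = 1`
    have hl : C.act g ^ D.l = 1 := by
      haveI := C.normal_PiXbar_subgroupOf
      have hidx : (D.PiXbar.subgroupOf D.PiX).index = D.l := hX
      have hm := Subgroup.pow_index_mem (D.PiXbar.subgroupOf D.PiX) (⟨g, hg⟩ : D.PiX)
      rw [hidx, Subgroup.mem_subgroupOf, SubgroupClass.coe_pow] at hm
      rw [← map_pow]
      exact C.act_eq_one_of_mem_PiXbar hm
    -- the order of `act g` divides `gcd(d+1, l) = 1`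
    have hcop : Nat.Coprime (d + 1) D.l := by
      have h2 : Nat.Coprime 2 D.l := (Nat.Coprime.coprime_dvd_right (by norm_num) D.coprime_six).symm
      have h3 : Nat.Coprime 3 D.l := (Nat.Coprime.coprime_dvd_right (by norm_num) D.coprime_six).symm
      have hd : d + 1 = 1 ∨ d + 1 = 2 ∨ d + 1 = 3 := by omega
      rcases hd with hd | hd | hd <;> rw [hd]
      · exact Nat.coprime_one_left _
      · exact h2
      · exact h3
    have hord : orderOf (C.act g) ∣ 1 := by
      rw [← Nat.Coprime.gcd_eq_one hcop]
      exact Nat.dvd_gcd (orderOf_dvd_of_pow_eq_one h1) (orderOf_dvd_of_pow_eq_one hl)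
    have hone : C.act g = 1 := orderOf_eq_one_iff.mp (Nat.dvd_one.mp hord)
    exact hgb ((C.mem_PiXbar_iff_act_eq_one hg).mpr hone)
  rcases lt_or_gt_of_ne hij with h | h
  · exact key i j h hj hfij
  · exact key j i h hi hfij.symm

/-! ### An element of `Π_X` moving `ε′` off `{ε⁰, ε′, ε″}` cannot normalise `jKer` -/

/-- For a nonzero cusp `y ∉ {ε′, ε″}`, `I_y ⊆ jKer` (its inertia is killed in `Δ_X̲ ↠ Δ_Θ`, and
`jKer = Π_{X̲→} ∩ Δ_C`). ([IUTchI] §1 p.37) [claim: Mochizuki2012, status: disputed] -/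
theorem ArrowCoveringClaims.inertia_le_jKer_of_ne (h : D.ArrowCoveringClaims) {y : D.Cusp}
    (hy0 : y ≠ D.ε0) (hy1 : y ≠ D.ε1) (hy2 : y ≠ D.ε2) : D.inertia y ≤ D.jKer := by
  rw [← h.piXarrow_inf_delta]
  exact le_inf (D.inertia_le_piXarrow_of_ne hy0 hy1 hy2) inf_le_right

/-- If `m ∈ Π_C` carries `ε′` to a cusp outside `{ε⁰, ε′, ε″}`, then conjugation by `m⁻¹` does NOT
preserve `jKer`: otherwise `m I_{ε′} m⁻¹`, which lies in a `Π_X̲`-conjugate of `I_{m·ε′} ⊆ jKer`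
(`act_decomp`, `jKer ⊴ Π_C̲`), would give `I_{ε′} ⊆ jKer ⊆ Π_{X̲→}`. ([IUTchI] Rmk 1.2.1 p.40)
[claim: Mochizuki2012, status: disputed] -/
theorem ArrowCoveringClaims.not_conj_jKer_of_act_ε1_not_mem (h : D.ArrowCoveringClaims)
    (C : D.CuspGalois) {m : D.PiC} (hy : C.act m D.ε1 ∉ ({D.ε0, D.ε1, D.ε2} : Set D.Cusp)) :
    ¬ (∀ z ∈ D.jKer, m⁻¹ * z * m ∈ D.jKer) := by
  intro hconj
  simp only [Set.mem_insert_iff, Set.mem_singleton_iff, not_or] at hy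
  obtain ⟨t, ht, hdec⟩ := C.act_decomp m D.ε1
  apply h.not_inertia_ε1_le_piXarrow
  intro x hx
  -- `(t m) x (t m)⁻¹ ∈ I_{m·ε′} ⊆ jKer`
  have h1 : MulAut.conj (t * m) • x ∈ D.decomp (C.act m D.ε1) := by
    rw [← hdec]; exact Subgroup.smul_mem_pointwise_smul _ _ _ hx.1
  rw [MulAut.smul_def, MulAut.conj_apply] at h1
  have h2 : t * m * x * (t * m)⁻¹ ∈ D.jKer :=
    h.inertia_le_jKer_of_ne hy.1 hy.2.1 hy.2.2 ⟨h1, D.E.normal_geom.conj_mem x hx.2 (t * m)⟩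
  -- conjugate back by `t⁻¹ ∈ Π_C̲`, then by `m⁻¹`
  have htC : t ∈ D.PiCbar := D.piXbar_le_piCbar ht
  have h2C : t * m * x * (t * m)⁻¹ ∈ D.PiCbar :=
    (D.jKer_le_deltaXbar.trans (D.deltaXbar_le_piXbar.trans D.piXbar_le_piCbar)) h2
  have h3 := h.jKer_normal.conj_mem ⟨_, h2C⟩ (Subgroup.mem_subgroupOf.mpr h2)
    ⟨t⁻¹, D.PiCbar.inv_mem htC⟩
  rw [Subgroup.mem_subgroupOf, Subgroup.coe_mul, Subgroup.coe_mul, Subgroup.coe_inv] at h3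
  have e : t⁻¹ * (t * m * x * (t * m)⁻¹) * t⁻¹⁻¹ = m * x * m⁻¹ := by group
  rw [e] at h3
  have h4 := hconj _ h3
  have e' : m⁻¹ * (m * x * m⁻¹) * m = x := by group
  rw [e'] at h4
  exact (le_sup_right : D.jKer ≤ D.piXarrow) h4

/-! ### Remark 1.2.1 -/

/-- **`N_{Π_C}(Π_{X̲→}) ∩ Π_X = Π_X̲`**: an element of `Π_X` normalising `Π_{X̲→}` lies in `Π_X̲` (under
the printed claims of p. 38, the cusp action and `[Π_X : Π_X̲] = l`). ([IUTchI] Rmk 1.2.1 p.40)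
[claim: Mochizuki2012, status: disputed] -/
theorem ArrowCoveringClaims.mem_piXbar_of_mem_normalizer_piXarrow (h : D.ArrowCoveringClaims)
    (C : D.CuspGalois) (hX : D.PiXbar.relIndex D.PiX = D.l) {g : D.PiC} (hg : g ∈ D.PiX)
    (hn : g ∈ Subgroup.normalizer (D.piXarrow : Set D.PiC)) : g ∈ D.PiXbar := by
  by_contra hgb
  obtain ⟨k, hk⟩ := C.exists_pow_act_not_mem_triple hX hg hgb D.ε1
  have hnk : g ^ k ∈ Subgroup.normalizer (D.piXarrow : Set D.PiC) := Subgroup.pow_mem _ hn k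
  refine h.not_conj_jKer_of_act_ε1_not_mem C hk fun z hz => ?_
  -- `g^k` normalises `Π_{X̲→}` and `Δ_C`, hence `jKer = Π_{X̲→} ∩ Δ_C`
  rw [← h.piXarrow_inf_delta] at hz ⊢
  refine ⟨?_, D.E.normal_geom.conj_mem' z hz.2 (g ^ k)⟩
  have := (Subgroup.mem_normalizer_iff''.mp hnk z).mp hz.1
  exact this

/-- **Remark 1.2.1, `X̲→`: `N_{Π_C}(Π_{X̲→}) = Π_C̲`** ("`Aut_k(X̲→) = Gal(X̲→/C̲)`", group level), under the
printed claims of p. 38, the cusp action and `[Π_X : Π_X̲] = l`. ([IUTchI] Rmk 1.2.1 p.40)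
[claim: Mochizuki2012, status: disputed] -/
theorem ArrowCoveringClaims.normalizer_piXarrow_eq (h : D.ArrowCoveringClaims) (C : D.CuspGalois)
    (hX : D.PiXbar.relIndex D.PiX = D.l) :
    Subgroup.normalizer (D.piXarrow : Set D.PiC) = D.PiCbar := by
  refine le_antisymm (fun n hn => ?_) h.piCbar_le_normalizer_piXarrow
  by_cases hnX : n ∈ D.PiX
  · exact (h.mem_piXbar_of_mem_normalizer_piXarrow C hX hnX hn).2
  · obtain ⟨c, hc, hcX⟩ := h.exists_mem_piCbar_not_mem_piX
    have hcn : c⁻¹ * n ∈ D.PiX := by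
      rw [Subgroup.mul_mem_iff_of_index_two D.index_piX]
      exact ⟨fun hci => absurd (D.PiX.inv_mem_iff.mp hci) hcX, fun hnX' => absurd hnX' hnX⟩
    have hcN : c⁻¹ * n ∈ Subgroup.normalizer (D.piXarrow : Set D.PiC) :=
      Subgroup.mul_mem _ (Subgroup.inv_mem _ (h.piCbar_le_normalizer_piXarrow hc)) hn
    have hb := h.mem_piXbar_of_mem_normalizer_piXarrow C hX hcn hcN
    rw [← mul_inv_cancel_left c n]
    exact D.PiCbar.mul_mem hc hb.2

/-- **Remark 1.2.1, `C̲→`: `N_{Π_C}(Π_{C̲→}) = Π_C̲`** ("`Aut_k(C̲→) = Gal(C̲→/C̲)`", group level): an element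
of `Π_X` normalising `Π_{C̲→}` normalises `Π_X̲ ∩ Π_{C̲→} = Π_{X̲→}` (`Π_X̲ ⊴ Π_C`), hence lies in `Π_X̲`.
([IUTchI] Rmk 1.2.1 p.40) [claim: Mochizuki2012, status: disputed] -/
theorem ArrowCoveringClaims.normalizer_piCarrow_eq (h : D.ArrowCoveringClaims) (C : D.CuspGalois)
    (hX : D.PiXbar.relIndex D.PiX = D.l) :
    Subgroup.normalizer (D.piCarrow : Set D.PiC) = D.PiCbar := by
  haveI := C.normal_PiXbar
  have key : ∀ n ∈ D.PiX, n ∈ Subgroup.normalizer (D.piCarrow : Set D.PiC) → n ∈ D.PiXbar := by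
    intro n hnX hn
    refine h.mem_piXbar_of_mem_normalizer_piXarrow C hX hnX ?_
    rw [Subgroup.mem_normalizer_iff]
    intro z
    rw [h.cartesian]
    refine ⟨fun hz => ⟨‹D.PiXbar.Normal›.conj_mem z hz.1 n, (Subgroup.mem_normalizer_iff.mp hn z).mp hz.2⟩,
      fun hz => ⟨?_, (Subgroup.mem_normalizer_iff.mp hn z).mpr hz.2⟩⟩
    have := ‹D.PiXbar.Normal›.conj_mem _ hz.1 n⁻¹
    rwa [inv_inv, ← mul_assoc, ← mul_assoc, inv_mul_cancel, one_mul, inv_mul_cancel_right] at this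
  refine le_antisymm (fun n hn => ?_) h.piCbar_le_normalizer_piCarrow
  by_cases hnX : n ∈ D.PiX
  · exact (key n hnX hn).2
  · obtain ⟨c, hc, hcX⟩ := h.exists_mem_piCbar_not_mem_piX
    have hcn : c⁻¹ * n ∈ D.PiX := by
      rw [Subgroup.mul_mem_iff_of_index_two D.index_piX]
      exact ⟨fun hci => absurd (D.PiX.inv_mem_iff.mp hci) hcX, fun hnX' => absurd hnX' hnX⟩
    have hcN : c⁻¹ * n ∈ Subgroup.normalizer (D.piCarrow : Set D.PiC) :=
      Subgroup.mul_mem _ (Subgroup.inv_mem _ (h.piCbar_le_normalizer_piCarrow hc)) hn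
    have hb := key _ hcn hcN
    rw [← mul_inv_cancel_left c n]
    exact D.PiCbar.mul_mem hc hb.2

/-- **[IUTchI] Remark 1.2.1** (p. 40), the typed predicate `Rmk121 D` — `N_{Π_C}(Π_{X̲→}) = Π_C̲`,
`N_{Π_C}(Π_{C̲→}) = Π_C̲`, `[Π_C̲ : Π_{X̲→}] = 2l`, `[Π_C̲ : Π_{C̲→}] = l` — HOLDS under the printed claims of
p. 38 (`ArrowCoveringClaims`), the cusp action (`CuspGalois`) and the law `[Π_X : Π_X̲] = l`.
([IUTchI] Rmk 1.2.1 p.40) [claim: Mochizuki2012, status: disputed] -/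
theorem ArrowCoveringClaims.rmk121 (h : D.ArrowCoveringClaims) (C : D.CuspGalois)
    (hX : D.PiXbar.relIndex D.PiX = D.l) : D.Rmk121 :=
  h.rmk121_of_normalizer_le (h.normalizer_piXarrow_eq C hX).le (h.normalizer_piCarrow_eq C hX).le

/-- The `hcard` spelling: `#Cusp(X̲) = l` (abc-iut-L5-t1 `CuspGalois.card_cusp`) in place of
`[Π_X : Π_X̲] = l`. ([IUTchI] Rmk 1.2.1 p.40) [claim: Mochizuki2012, status: disputed] -/
theorem ArrowCoveringClaims.rmk121_of_card (h : D.ArrowCoveringClaims) (C : D.CuspGalois)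
    (hcard : Nat.card D.Cusp = D.l) : D.Rmk121 :=
  h.rmk121 C (C.card_cusp.symm.trans hcard)

/-- **Corollary 1.2 from isomorphisms of the `k`-cores, Remark 1.2.1 discharged**: the assembly
`characteristicNatureOfCoverings_of_core_isos` (`…Cores`, p407653) with its `Rmk121` hypotheses
supplied by `ArrowCoveringClaims.rmk121` (cusp actions and the law `[Π_X : Π_X̲] = l` instead).
([IUTchI] Cor 1.2 p.39) [claim: Mochizuki2012, status: disputed] -/
theorem characteristicNatureOfCoverings_of_core_isos' {D' : PuncturedEllipticData.{u}}
    (h : D.ArrowCoveringClaims) (h' : D'.ArrowCoveringClaims) (C : D.CuspGalois) (C' : D'.CuspGalois)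
    (hX : D.PiXbar.relIndex D.PiX = D.l) (hX' : D'.PiXbar.relIndex D'.PiX = D'.l)
    (hXa : ∀ φ : D.piXarrow ≃* D'.piXarrow, Continuous φ → Continuous φ.symm →
      ∃ Θ : D.PiC ≃* D'.PiC, Continuous Θ ∧ (∀ x : D.piXarrow, Θ (x : D.PiC) = (φ x : D'.PiC)) ∧
        (fun K => (K.map D.PiCbar.subtype).map Θ.toMonoidHom) '' D.cuspClassX =
          (fun K' => K'.map D'.PiCbar.subtype) '' D'.cuspClassX ∧
        (fun K => (K.map D.PiCbar.subtype).map Θ.toMonoidHom) '' D.cuspClassC =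
          (fun K' => K'.map D'.PiCbar.subtype) '' D'.cuspClassC)
    (hC : ∀ ψ : D.piCarrow ≃* D'.piCarrow, Continuous ψ → Continuous ψ.symm →
      ∃ Θ : D.PiC ≃* D'.PiC, Continuous Θ ∧ (∀ x : D.piCarrow, Θ (x : D.PiC) = (ψ x : D'.PiC)) ∧
        (fun K => (K.map D.PiCbar.subtype).map Θ.toMonoidHom) '' D.cuspClassC =
          (fun K' => K'.map D'.PiCbar.subtype) '' D'.cuspClassC) :
    D.CharacteristicNatureOfCoverings D' :=
  characteristicNatureOfCoverings_of_core_isos h h' (h.rmk121 C hX) (h'.rmk121 C' hX') hXa hC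

end PuncturedEllipticData

end Literature.IUT.HodgeTheaters
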